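import Mathlib
import HarnessLib
import Literature.Computability.AlgebraicComplexity.PatternExpressions
import Literature.Combinatorics.SimpleGraph.TreeDecomposition
import Literature.Combinatorics.SimpleGraph.ChordalTreeDecomposition
import Summits.ValiantsHypothesis.ValiantsHypothesis.Theorems.MonotoneRestorationMonotoneRestorationQPLinearWidthCaterpillarHom

/-!
# Route MonotoneRestoration, crux `MonotoneRestorationQP` (stmt-15886), line `linear-width` —
# THE `HomIndist` CLASSES ARE STABLE UNDER THE AFFINE PENCIL `A ↦ s·A + t·J`

Helper file (`--supports stmt-ValiantsHypothesis-15886`), def-free.  For the width hypothesis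
`PolylogHomDetermined` of the graded family `WidthRung d` (built from `HomIndist n k A B`: equal values of
all homomorphism polynomials `hom_{F,n}` of bipartite multigraph patterns of treewidth `< k`), this file
certifies a structural fact about the equivalence `HomIndist n k` on `ℂ^{n×n}` that has no counterpart for
`0/1` host graphs:

* `eval_homPoly_affine` — BINOMIAL EXPANSION ALONG THE PENCIL: for every pattern `E` and scalars `s, t`,
  `hom_{E,n}(s·A + t·J) = Σ_{(E₁,E₂) ∈ antidiagonal E} s^{|E₁|} t^{|E₂|} · hom_{E₁,n}(A)` — a combination
  of the homomorphism polynomials of the SUB-patterns `E₁ ≤ E` on the same vertex set (all-ones matrix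
  `J`; `Multiset.prod_map_add`);
* `treewidth_patternGraph_mono` — sub-patterns have pattern graphs of no larger treewidth
  (`treewidth_mono`);
* `homIndist_affine` — hence `HomIndist n k A B → HomIndist n k (s·A + t·J) (s·B + t·J)` for all
  `s, t ∈ ℂ` (the line's definition unfolded verbatim): every `HomIndist n k`-class is carried to a
  `HomIndist n k`-class by each map of the pencil, and the set of pairs not separated below treewidth `k`
  is a union of such pencils;
* `eval_eq_affine_of_determined` — so a polynomial `p` determined by `HomIndist n k` (the level-`n` clause
  of `PolylogHomDetermined`) satisfies `p(s·A + t·J) = p(s·B + t·J)` for all `s, t` whenever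
  `HomIndist n k A B`: the whole two-parameter family of values agrees, not just the value at `A`.

Use for the line: the algebraic question behind `stub_linearDegreeWidthRestoration` / K1 ("is every
polynomial determined by `HomIndist n k` in the span of the `hom_{F,n}`, `tw F < k`?", open) concerns a
graded subalgebra stable under the substitutions `X ↦ s·X + t·J`; in particular (coefficient of `s^d` at
`t = 0`) it is stable under taking homogeneous components.  Honest label: structural calibration; no stub
closed; VP ≠ VNP not moved. [cite: DwivediPagoSeppelt2026, Def. 3.2]
-/

-- `Summit.ValiantsHypothesis.ValiantsHypothesis.…` is the tree's mandated namespace (Sub = Summit).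
set_option linter.dupNamespace false

noncomputable section

namespace Summit.ValiantsHypothesis.ValiantsHypothesis.Theorems

namespace AffinePencil

open Literature.Computability.AlgebraicComplexity MvPolynomial

variable {n : ℕ}

/-! ### Binomial expansion along the pencil -/

/-- **`hom_{E,n}(s·A + t·J)` is a binomial combination of the `hom_{E₁,n}(A)`, `E₁ ≤ E`.** [folklore] -/
theorem eval_homPoly_affine {a b : ℕ} (E : Multiset (Fin a × Fin b)) (A : Fin n × Fin n → ℂ)
    (s t : ℂ) :
    eval (fun ij => s * A ij + t) (homPoly E n ℂ) =
      ((Multiset.antidiagonal E).map fun P =>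
        s ^ Multiset.card P.1 * t ^ Multiset.card P.2 * eval A (homPoly P.1 n ℂ)).sum := by
  rw [CaterpillarHom.eval_homPoly]
  simp_rw [CaterpillarHom.eval_homPoly]
  -- expand each product binomially
  have hexp : ∀ h : (Fin a → Fin n) × (Fin b → Fin n),
      (E.map fun e => s * A (h.1 e.1, h.2 e.2) + t).prod =
        ((Multiset.antidiagonal E).map fun P =>
          s ^ Multiset.card P.1 * t ^ Multiset.card P.2 *
            (P.1.map fun e => A (h.1 e.1, h.2 e.2)).prod).sum := by
    intro h
    rw [Multiset.prod_map_add]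
    refine congr_arg _ (Multiset.map_congr rfl fun P _ => ?_)
    rw [Multiset.prod_map_mul, Multiset.map_const', Multiset.prod_replicate, Multiset.map_const',
      Multiset.prod_replicate]
    ring
  simp_rw [hexp]
  -- swap the two sums
  rw [Finset.sum_eq_multiset_sum, Multiset.sum_map_sum_map]
  refine congr_arg _ (Multiset.map_congr rfl fun P _ => ?_)
  rw [← Finset.sum_eq_multiset_sum, ← Finset.mul_sum]

/-! ### Sub-patterns are no wider -/

/-- The pattern graph of a sub-multiset is a subgraph, so its treewidth is no larger. [folklore] -/
theorem treewidth_patternGraph_mono {a b : ℕ} {E₁ E : Multiset (Fin a × Fin b)} (h : E₁ ≤ E) :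
    Literature.Combinatorics.SimpleGraph.treewidth
        (SimpleGraph.fromRel fun u v : Fin a ⊕ Fin b => ∃ p ∈ E₁, u = Sum.inl p.1 ∧ v = Sum.inr p.2) ≤
      Literature.Combinatorics.SimpleGraph.treewidth
        (SimpleGraph.fromRel fun u v : Fin a ⊕ Fin b => ∃ p ∈ E, u = Sum.inl p.1 ∧ v = Sum.inr p.2) := by
  refine Literature.Combinatorics.SimpleGraph.treewidth_mono fun u v huv => ?_
  rw [SimpleGraph.fromRel_adj] at huv ⊢
  refine ⟨huv.1, huv.2.imp ?_ ?_⟩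
  · rintro ⟨p, hp, hu, hv⟩
    exact ⟨p, Multiset.mem_of_le h hp, hu, hv⟩
  · rintro ⟨p, hp, hu, hv⟩
    exact ⟨p, Multiset.mem_of_le h hp, hu, hv⟩

/-! ### Stability of `HomIndist n k` under the pencil -/

/-- **`HomIndist n k A B → HomIndist n k (s·A + t·J) (s·B + t·J)`** (the definition of line
`linear-width`, unfolded verbatim). [cite: DwivediPagoSeppelt2026, Def. 3.2] -/
theorem homIndist_affine {k : ℕ} (A B : Fin n × Fin n → ℂ)
    (hind : ∀ (a b : ℕ) (E : Multiset (Fin a × Fin b)),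
      Literature.Combinatorics.SimpleGraph.treewidth
        (SimpleGraph.fromRel fun u v : Fin a ⊕ Fin b => ∃ p ∈ E, u = Sum.inl p.1 ∧ v = Sum.inr p.2) < k →
      eval A (homPoly E n ℂ) = eval B (homPoly E n ℂ))
    (s t : ℂ) :
    ∀ (a b : ℕ) (E : Multiset (Fin a × Fin b)),
      Literature.Combinatorics.SimpleGraph.treewidth
        (SimpleGraph.fromRel fun u v : Fin a ⊕ Fin b => ∃ p ∈ E, u = Sum.inl p.1 ∧ v = Sum.inr p.2) < k →
      eval (fun ij => s * A ij + t) (homPoly E n ℂ) = eval (fun ij => s * B ij + t) (homPoly E n ℂ) := by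
  intro a b E hE
  rw [eval_homPoly_affine, eval_homPoly_affine]
  refine congr_arg _ (Multiset.map_congr rfl fun P hP => ?_)
  have hle : P.1 ≤ E := by
    rw [Multiset.mem_antidiagonal] at hP
    exact hP ▸ Multiset.le_add_right _ _
  rw [hind a b P.1 ((treewidth_patternGraph_mono hle).trans_lt hE)]

/-- **A polynomial determined by `HomIndist n k` agrees along the whole pencil.**  If `p` takes equal
values at any two points hom-indistinguishable below treewidth `k` (the level-`n` clause of
`PolylogHomDetermined`), then `p(s·A + t·J) = p(s·B + t·J)` for all `s, t` whenever `HomIndist n k A B`.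
[folklore] -/
theorem eval_eq_affine_of_determined {k : ℕ} (p : MvPolynomial (Fin n × Fin n) ℂ)
    (hp : ∀ A B : Fin n × Fin n → ℂ,
      (∀ (a b : ℕ) (E : Multiset (Fin a × Fin b)),
        Literature.Combinatorics.SimpleGraph.treewidth
          (SimpleGraph.fromRel fun u v : Fin a ⊕ Fin b => ∃ p ∈ E, u = Sum.inl p.1 ∧ v = Sum.inr p.2) < k →
        eval A (homPoly E n ℂ) = eval B (homPoly E n ℂ)) →
      eval A p = eval B p)
    (A B : Fin n × Fin n → ℂ)
    (hind : ∀ (a b : ℕ) (E : Multiset (Fin a × Fin b)),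
      Literature.Combinatorics.SimpleGraph.treewidth
        (SimpleGraph.fromRel fun u v : Fin a ⊕ Fin b => ∃ p ∈ E, u = Sum.inl p.1 ∧ v = Sum.inr p.2) < k →
      eval A (homPoly E n ℂ) = eval B (homPoly E n ℂ))
    (s t : ℂ) :
    eval (fun ij => s * A ij + t) p = eval (fun ij => s * B ij + t) p :=
  hp _ _ (homIndist_affine A B hind s t)

end AffinePencil

end Summit.ValiantsHypothesis.ValiantsHypothesis.Theorems

end
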